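import Literature.Analysis.Complex.VitaliConvergence
import Mathlib.Analysis.Complex.TaylorSeries
import Mathlib.Analysis.Normed.Module.Convex
import Mathlib.Analysis.Convex.PathConnected
import Summits.CriticalPhenomena.CardyFormulaZ2.Theses.CardyQContinuation

/-!
# Route `CardyQContinuation` — support item `JetLimitLemma` (Vitali–Porter, jet form)

Item `stmt-CriticalPhenomena-5563` of route `route-CriticalPhenomena-CardyQContinuation`
(sub-problem `CardyFormulaZ2`): on the thickened segment
`T_ρ = ρ`-neighbourhood of `[1, √2] ⊆ ℂ` (open and convex), a family `f δ`, holomorphic on `T_ρ`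
and bounded by one constant `M` there for all small `δ > 0`, all of whose `s`-jets at one point
`z₀ ∈ T_ρ` converge as `δ → 0⁺`, converges pointwise on `T_ρ` to a holomorphic `g` whose jets at
`z₀` are the limits of the jets.

This is Vitali's convergence theorem in its "jet" form (Vitali 1903 / Porter 1904; Remmert,
*Classical topics in complex function theory*, §7.3: for a locally bounded sequence of holomorphic
functions on a domain, convergence of all derivatives at one point ⇔ compact convergence). Proof:
Montel's theorem and the subsequence principle as packaged in the tree
(`Literature.Analysis.Complex.exists_tendstoLocallyUniformlyOn_of_unique_limits`), the
uniqueness of subsequential limits coming from the identity theorem in jet form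
(`eqOn_of_forall_iteratedDeriv_eq`: equal jets at a point of a preconnected open set ⇒ equal,
via `Complex.taylorSeries_eq_on_ball`) together with the passage of jets to locally uniform
limits (`TendstoLocallyUniformlyOn.deriv`, iterated); the real-parameter filter `𝓝[>] 0` is
reduced to sequences (`Filter.tendsto_of_seq_tendsto`), the limit being independent of the
sequence by the same identity theorem; the "eventually holomorphic and bounded" hypothesis is
normalised to "always" by freezing the family at one good parameter outside the good set.
-/

noncomputable section

open Filter Set Metric Topology

namespace Summit.CriticalPhenomena.CardyFormulaZ2.Theorems

namespace JetLimit

/-- **Jets pass to locally uniform limits of holomorphic functions**: if holomorphic `F i → f`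
locally uniformly on an open `U ⊆ ℂ`, then `(F i)⁽ᵐ⁾ → f⁽ᵐ⁾` locally uniformly on `U` for
every `m` (Weierstrass; `TendstoLocallyUniformlyOn.deriv` iterated). [folklore] -/
theorem tendstoLocallyUniformlyOn_iteratedDeriv {ι : Type*} {φ : Filter ι} {U : Set ℂ}
    (hU : IsOpen U) {F : ι → ℂ → ℂ} {f : ℂ → ℂ} (hF : ∀ i, DifferentiableOn ℂ (F i) U)
    (hf : TendstoLocallyUniformlyOn F f φ U) (m : ℕ) :
    TendstoLocallyUniformlyOn (fun i => iteratedDeriv m (F i)) (iteratedDeriv m f) φ U := by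
  induction m with
  | zero => simpa only [iteratedDeriv_zero] using hf
  | succ m ih =>
    have hFm : ∀ᶠ i in φ, DifferentiableOn ℂ (iteratedDeriv m (F i)) U :=
      Eventually.of_forall fun i => by
        rw [iteratedDeriv_eq_iterate]
        exact (((hF i).analyticOnNhd hU).iterated_deriv m).differentiableOn
    have h := ih.deriv hFm hU
    simpa only [iteratedDeriv_succ, Function.comp_def] using h

/-- **Identity theorem, jet form**: two holomorphic functions on a preconnected open `U ⊆ ℂ`
with the same jets at one point `z₀ ∈ U` agree on `U` (both equal their common Taylor series on
a disc about `z₀`, `Complex.taylorSeries_eq_on_ball`, then the identity theorem). [folklore] -/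
theorem eqOn_of_forall_iteratedDeriv_eq {U : Set ℂ} (hU : IsOpen U) (hUc : IsPreconnected U)
    {f g : ℂ → ℂ} (hf : DifferentiableOn ℂ f U) (hg : DifferentiableOn ℂ g U) {z₀ : ℂ}
    (hz₀ : z₀ ∈ U) (h : ∀ n, iteratedDeriv n f z₀ = iteratedDeriv n g z₀) : EqOn f g U := by
  obtain ⟨r, hr, hrU⟩ := Metric.isOpen_iff.1 hU z₀ hz₀
  have hfg : f =ᶠ[𝓝 z₀] g := by
    filter_upwards [Metric.ball_mem_nhds z₀ hr] with z hz
    rw [← Complex.taylorSeries_eq_on_ball (hf.mono hrU) hz,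
      ← Complex.taylorSeries_eq_on_ball (hg.mono hrU) hz]
    simp only [h]
  exact (hf.analyticOnNhd hU).eqOn_of_preconnected_of_eventuallyEq (hg.analyticOnNhd hU) hUc
    hz₀ hfg

/-- **Vitali's theorem, jet form, for sequences**: a locally bounded sequence of holomorphic
functions on a preconnected open `U ⊆ ℂ`, all of whose jets at one point `z₀ ∈ U` converge,
converges locally uniformly on `U` to a holomorphic function with the limiting jets at `z₀`
(Montel + subsequence principle; uniqueness of the subsequential limits by the jet form of the
identity theorem). [folklore] -/
theorem exists_tendstoLocallyUniformlyOn_of_tendsto_iteratedDeriv {U : Set ℂ} (hU : IsOpen U)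
    (hUc : IsPreconnected U) {F : ℕ → ℂ → ℂ} (hF : ∀ n, DifferentiableOn ℂ (F n) U)
    (hb : ∀ a ∈ U, ∃ M : ℝ, ∃ r > 0, ∀ n, ∀ z ∈ ball a r ∩ U, ‖F n z‖ ≤ M)
    {z₀ : ℂ} (hz₀ : z₀ ∈ U) {c : ℕ → ℂ}
    (hc : ∀ m, Tendsto (fun n => iteratedDeriv m (F n) z₀) atTop (𝓝 (c m))) :
    ∃ g : ℂ → ℂ, DifferentiableOn ℂ g U ∧ TendstoLocallyUniformlyOn F g atTop U ∧
      ∀ m, iteratedDeriv m g z₀ = c m := by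
  -- the jets at `z₀` of any subsequential locally uniform limit are the `c m`
  have hjet : ∀ (f : ℂ → ℂ) (ψ : ℕ → ℕ), StrictMono ψ →
      TendstoLocallyUniformlyOn (fun n => F (ψ n)) f atTop U → ∀ m, iteratedDeriv m f z₀ = c m := by
    intro f ψ hψ hlim m
    have h1 := (tendstoLocallyUniformlyOn_iteratedDeriv hU (fun n => hF (ψ n)) hlim m).tendsto_at
      hz₀
    have h2 : Tendsto (fun n => iteratedDeriv m (F (ψ n)) z₀) atTop (𝓝 (c m)) :=
      (hc m).comp hψ.tendsto_atTop
    exact tendsto_nhds_unique h1 h2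
  obtain ⟨g, hg, hlim⟩ :=
    Literature.Analysis.Complex.exists_tendstoLocallyUniformlyOn_of_unique_limits hU hF hb
      fun f f' ψ ψ' hψ hψ' hlim hlim' =>
        eqOn_of_forall_iteratedDeriv_eq hU hUc
          (hlim.differentiableOn (Eventually.of_forall fun n => hF _) hU)
          (hlim'.differentiableOn (Eventually.of_forall fun n => hF _) hU) hz₀
          fun m => by rw [hjet f ψ hψ hlim m, hjet f' ψ' hψ' hlim' m]
  exact ⟨g, hg, hlim, hjet g id strictMono_id (by simpa using hlim)⟩

/-- **Vitali's theorem, jet form, along a countably generated filter** (uniformly bounded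
case): holomorphic `F i` on a preconnected open `U ⊆ ℂ`, bounded by one constant, all of whose
jets at `z₀ ∈ U` converge along `l`, converge pointwise on `U` along `l` to a holomorphic `g`
with the limiting jets at `z₀` (reduction to sequences; the limit does not depend on the sequence
by the jet form of the identity theorem). [folklore] -/
theorem exists_tendsto_of_tendsto_iteratedDeriv {ι : Type*} {l : Filter ι} [l.NeBot]
    [l.IsCountablyGenerated] {U : Set ℂ} (hU : IsOpen U) (hUc : IsPreconnected U)
    {F : ι → ℂ → ℂ} {M : ℝ} (hF : ∀ i, DifferentiableOn ℂ (F i) U)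
    (hM : ∀ i, ∀ z ∈ U, ‖F i z‖ ≤ M) {z₀ : ℂ} (hz₀ : z₀ ∈ U) {c : ℕ → ℂ}
    (hc : ∀ m, Tendsto (fun i => iteratedDeriv m (F i) z₀) l (𝓝 (c m))) :
    ∃ g : ℂ → ℂ, DifferentiableOn ℂ g U ∧ (∀ m, iteratedDeriv m g z₀ = c m) ∧
      ∀ z ∈ U, Tendsto (fun i => F i z) l (𝓝 (g z)) := by
  have hseq : ∀ x : ℕ → ι, Tendsto x atTop l → ∃ g : ℂ → ℂ, DifferentiableOn ℂ g U ∧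
      TendstoLocallyUniformlyOn (fun n => F (x n)) g atTop U ∧ ∀ m, iteratedDeriv m g z₀ = c m :=
    fun x hx => exists_tendstoLocallyUniformlyOn_of_tendsto_iteratedDeriv hU hUc (fun n => hF (x n))
      (fun _ _ => ⟨M, 1, one_pos, fun n z hz => hM (x n) z hz.2⟩) hz₀ fun m => (hc m).comp hx
  obtain ⟨x₀, hx₀⟩ := l.exists_seq_tendsto
  obtain ⟨g, hg, -, hgc⟩ := hseq x₀ hx₀
  refine ⟨g, hg, hgc, fun z hz => tendsto_of_seq_tendsto fun x hx => ?_⟩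
  obtain ⟨g', hg', hlim', hgc'⟩ := hseq x hx
  have heq : EqOn g' g U :=
    eqOn_of_forall_iteratedDeriv_eq hU hUc hg' hg hz₀ fun m => by rw [hgc m, hgc' m]
  have h := hlim'.tendsto_at hz
  rw [heq hz] at h
  exact h

/-- The thickened segment `T_ρ = {z : dist(z, [1, √2]) < ρ}` is preconnected (it is convex, as a
thickening of the convex segment `[1, √2] ⊆ ℝ ⊆ ℂ`). [folklore] -/
theorem isPreconnected_thickening_segment (ρ : ℝ) :
    IsPreconnected (Metric.thickening ρ (((↑) : ℝ → ℂ) '' Set.Icc (1:ℝ) (Real.sqrt 2))) := by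
  refine (Convex.thickening ?_ ρ).isPreconnected
  refine (convex_Icc (1:ℝ) (Real.sqrt 2)).is_linear_image ⟨fun x y => Complex.ofReal_add x y, ?_⟩
  intro a x
  simp only [smul_eq_mul, Complex.ofReal_mul, Complex.real_smul]

end JetLimit

open Summit.CriticalPhenomena.CardyFormulaZ2.Theses

/-- **`JetLimitLemma`** (item `stmt-CriticalPhenomena-5563`, route `CardyQContinuation`): on the
thickened segment `T_ρ` of `[1, √2]`, a family `f δ` which for all small `δ > 0` is holomorphic on
`T_ρ` and bounded by `M` there, and all of whose jets at a point `z₀ ∈ T_ρ` converge as `δ → 0⁺`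
(to `c n`), converges pointwise on `T_ρ` as `δ → 0⁺` to a holomorphic `g` with
`g⁽ⁿ⁾(z₀) = c n`. Vitali–Porter in jet form (`JetLimit.exists_tendsto_of_tendsto_iteratedDeriv`)
after freezing the family at one good parameter wherever the eventual hypothesis fails. -/
theorem cardyQContinuation_jetLimitLemma_proof : CardyQContinuation.JetLimitLemma := by
  unfold CardyQContinuation.JetLimitLemma
  intro ρ _hρ f M z₀ c hz₀ hev hjet
  set T : Set ℂ := Metric.thickening ρ (((↑) : ℝ → ℂ) '' Set.Icc (1:ℝ) (Real.sqrt 2)) with hT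
  have hTo : IsOpen T := Metric.isOpen_thickening
  have hTc : IsPreconnected T := JetLimit.isPreconnected_thickening_segment ρ
  -- freeze the family at one good parameter outside the good set
  obtain ⟨δ₁, hδ₁⟩ := hev.exists
  classical
  set F : ℝ → ℂ → ℂ := fun δ =>
    if DifferentiableOn ℂ (f δ) T ∧ ∀ z ∈ T, ‖f δ z‖ ≤ M then f δ else f δ₁ with hF
  have hFall : ∀ δ, DifferentiableOn ℂ (F δ) T ∧ ∀ z ∈ T, ‖F δ z‖ ≤ M := by
    intro δ
    by_cases h : DifferentiableOn ℂ (f δ) T ∧ ∀ z ∈ T, ‖f δ z‖ ≤ M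
    · simp only [hF, if_pos h]; exact h
    · simp only [hF, if_neg h]; exact hδ₁
  have hFeq : ∀ᶠ δ in 𝓝[>] (0:ℝ), F δ = f δ := hev.mono fun δ h => if_pos h
  have hjet' : ∀ n, Tendsto (fun δ => iteratedDeriv n (F δ) z₀) (𝓝[>] (0:ℝ)) (𝓝 (c n)) :=
    fun n => (hjet n).congr' (hFeq.mono fun δ h => by simp only [h])
  obtain ⟨g, hg, hgc, hlim⟩ := JetLimit.exists_tendsto_of_tendsto_iteratedDeriv hTo hTc
    (fun δ => (hFall δ).1) (fun δ => (hFall δ).2) hz₀ hjet'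
  exact ⟨g, hg, hgc, fun z hz => (hlim z hz).congr' (hFeq.mono fun δ h => by simp only [h])⟩

end Summit.CriticalPhenomena.CardyFormulaZ2.Theorems

end
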